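import Summits.Ventures.HSemireg.WedgeHankelRecurrenceGaussChebyshevCGcd

/-!
# Venture HSemireg — **THE THREE CHEBYSHEV RESULTANT CLOSED FORMS OVER EVERY COMMUTATIVE RING** (`Res(U_m,U_n)`, `Res(T_m,T_n)`, `Res(T_m,U_n)` with Mathlib's formal degrees): the integer
# identities N460 ∕ N461 ∕ N464 pushed through `Int.castRingHom R` by `Res(f.map φ, g.map φ) = φ(Res(f,g))` and `map φ T_n = T_n`, `map φ U_n = U_n` — so e.g. in characteristic `p` the
# resultant is the stated power of `2` reduced mod `p` (and vanishes in characteristic `2` as soon as the exponent is positive)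

HONEST FRAMING. Part of the Lean index of the computation cell `pub-hsemireg` (seat p10 gen 48, Sunday typer «UNIFORM-IN-n»).  Polynomial ∕ resultant algebra only; no variety, no cohomology theory,
no sheaf, no Ext group and no semiregularity map is constructed here; nothing here says that HC / HC_CM / HC_AV holds; no Literature fact (unproved `Prop`) is declared or used.  Custodian versions
as in `WedgeHankelSiegelIdeal` (1/3).
SOURCES (cited).  K. Dilcher, K. B. Stolarsky, Trans. Amer. Math. Soc. 357 (2005) 965–981, §3; D. P. Jacobs, M. O. Rayes, V. Trevisan, Canad. Math. Bull. 54 (2011) 288–296.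
PROOF TYPED HERE.  N460 `chebyshevU_resultant_closed`, N461 `chebyshevT_resultant_closed`, N464 `chebyshevTU_resultant_closed`; Mathlib `resultant_map_map`, `map_T`, `map_U`, `apply_ite`, `map_pow`,
`map_neg`, `map_one`, `eq_intCast`.
DEDUP DISCLOSURE (`rg -n '_resultant_closed_ring' Summits Literature HarnessLib`, 2026-09-04): N406 `chebyshevT_resultant_ring ∕ chebyshevU_resultant_ring` (consecutive pairs over any ring); 0 hits for
the 3 names below.

WHAT IS IN THE TREE.  N406, N460, N461, N464.
THIS FILE (namespace `Summit.Ventures.HSemireg.Wedge.HankelOuter` continued; CHAINED on N466; 0 definitions):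
* §1232 **`chebyshevU_resultant_closed_ring`**, **`chebyshevT_resultant_closed_ring`**, **`chebyshevTU_resultant_closed_ring`**.
CAVEATS.  `ℕ`-division ∕ subtraction conventions as in N460 ∕ N461 ∕ N464.  Formal degrees explicit.  Nothing Ext-side.  New names only.
-/

open Module Polynomial
open scoped Matrix Polynomial

namespace Summit.Ventures.HSemireg.Wedge.HankelOuter

/-! ## §1232. The closed forms over every commutative ring -/

/-- **`Res_{(m,n)}(U_m, U_n) = (−1)^{mn∕2} 2^{mn}` if `gcd(m+1,n+1) = 1` and `0` otherwise, in EVERY commutative ring.** [Dilcher–Stolarsky 2005 Thm 3.1, via N460; this file, §1232] -/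
theorem chebyshevU_resultant_closed_ring (R : Type*) [CommRing R] (m n : ℕ) :
    (Polynomial.Chebyshev.U R (m : ℤ)).resultant (Polynomial.Chebyshev.U R (n : ℤ)) m n = if Nat.Coprime (m + 1) (n + 1) then (-1) ^ (m * n / 2) * 2 ^ (m * n) else 0 := by
  have hmap := Polynomial.resultant_map_map (f := Polynomial.Chebyshev.U ℤ (m : ℤ)) (g := Polynomial.Chebyshev.U ℤ (n : ℤ)) (m := m) (n := n) (Int.castRingHom R)
  rw [Polynomial.Chebyshev.map_U, Polynomial.Chebyshev.map_U, chebyshevU_resultant_closed, apply_ite (Int.castRingHom R)] at hmap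
  rw [hmap, map_zero, map_mul, map_pow, map_pow, map_neg, map_one, map_ofNat]

/-- **`Res_{(m,n)}(T_m, T_n) = 0` if `m ∕ gcd`, `n ∕ gcd` are both odd, `= (−1)^{mn∕2} 2^{mn + gcd − m − n}` otherwise, in EVERY commutative ring.** [Dilcher–Stolarsky 2005 Thm 3.3, via N461;
this file, §1232] -/
theorem chebyshevT_resultant_closed_ring (R : Type*) [CommRing R] (m n : ℕ) :
    (Polynomial.Chebyshev.T R (m : ℤ)).resultant (Polynomial.Chebyshev.T R (n : ℤ)) m n =
      if Odd (m / Nat.gcd m n) ∧ Odd (n / Nat.gcd m n) then 0 else (-1) ^ (m * n / 2) * 2 ^ (m * n + Nat.gcd m n - m - n) := by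
  have hmap := Polynomial.resultant_map_map (f := Polynomial.Chebyshev.T ℤ (m : ℤ)) (g := Polynomial.Chebyshev.T ℤ (n : ℤ)) (m := m) (n := n) (Int.castRingHom R)
  rw [Polynomial.Chebyshev.map_T, Polynomial.Chebyshev.map_T, chebyshevT_resultant_closed, apply_ite (Int.castRingHom R)] at hmap
  rw [hmap, map_zero, map_mul, map_pow, map_pow, map_neg, map_one, map_ofNat]

/-- **`Res_{(m,n)}(T_m, U_n) = 0` if `(n+1) ∕ gcd(m,n+1)` is even, `= (−1)^{mn∕2} 2^{mn + gcd(m,n+1) − n − 1}` otherwise, in EVERY commutative ring.** [Dilcher–Stolarsky 2005 §3, via N464;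
this file, §1232] -/
theorem chebyshevTU_resultant_closed_ring (R : Type*) [CommRing R] (m n : ℕ) :
    (Polynomial.Chebyshev.T R (m : ℤ)).resultant (Polynomial.Chebyshev.U R (n : ℤ)) m n =
      if Even ((n + 1) / Nat.gcd m (n + 1)) then 0 else (-1) ^ (m * n / 2) * 2 ^ (m * n + Nat.gcd m (n + 1) - n - 1) := by
  have hmap := Polynomial.resultant_map_map (f := Polynomial.Chebyshev.T ℤ (m : ℤ)) (g := Polynomial.Chebyshev.U ℤ (n : ℤ)) (m := m) (n := n) (Int.castRingHom R)
  rw [Polynomial.Chebyshev.map_T, Polynomial.Chebyshev.map_U, chebyshevTU_resultant_closed, apply_ite (Int.castRingHom R)] at hmap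
  rw [hmap, map_zero, map_mul, map_pow, map_pow, map_neg, map_one, map_ofNat]

end Summit.Ventures.HSemireg.Wedge.HankelOuter
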